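import Summits.ResolutionOfSingularities.ResolutionOfSingularities.Theorems.HilbertSamuelEliminationCampaignW42TertiaryStrictTransformParts
import HarnessLib

/-!
# [OURS · L1 W4.2] The resolution cycles of `S(X, ν)` are sound: every canonical centre at an isolated origin is REGULAR,
# PERMISSIBLE and INSIDE THE `ν`-STRATUM, for every admissible oracle — hypothesis (H3) of the O2 ⇒ `ν`-modification
# bridge is DISCHARGED (`--supports stmt-ResolutionOfSingularities-17846`)

OURS (slot W4.2 of cell res-hironaka, LADDER-RESOLUTION rung L, D-0089; prover seat res-L1-s42-pv-2, gen 2); NOT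
statements of H. Hironaka's manuscript [Hironaka2017]; nothing of the manuscript is used or asserted. AI review is
weaker than expert review. Pure PROOF file; no new definition (the cycle invariant is spelled inline).

CJS Rem. 6.29 (1) replays, inside `X`, the canonical resolution sequence `Y_{j,0} ← Y_{j,1} ← ⋯ ← Y_{j,m}` of the
label-`j` part `Y_r^{(j)}` of the `ν`-stratum, «identifying `Y_{j,i}` with the strict transform» and using
«`Y_{j,i} = Y_{r+i}^{(j)}`» (p. 92), so that the cycle-ending centre `Y_{r+m}^{(j)} = Y_{j,m}` is regular and all
centres are permissible «by Lemma 5.34 (3)». In the tree's rendering (`IsCanonicalStep`, `Labelling.next`, `Pending`)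
this is THE CYCLE INVARIANT, carried here along every canonical run from an isolated origin:

  «the replayed subscheme IS the label-`j` part of the current `ν`-stratum (`Set.range Q.hom = L.part (X_n(ν)) Q.lbl`),
   its label is not newer than the year, the centres still to be replayed are permissible, and the last stage of the
   replayed sequence is regular»

together with: stage of finite type over the ground field, reduced, `dim ≤ N`, `ν` never exceeded, labels `≤` year.

* `isRegular_subscheme_map_of_isClosedImmersion`, `isRegular_subscheme_of_isPermissible` — replayed centres `φ_* D`
  of permissible `D` are regular closed subschemes.
* `isCanonicalStep_cycle_package` — ONE CANONICAL STEP from a state satisfying the invariant, for an ADMISSIBLE oracle: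
  the centre is REGULAR (cycle start with empty answer: the part itself, regular by admissibility; replay: `φ_* D`;
  cycle end: the part = the replayed regular last stage, `isRegular_subscheme_vanishingIdeal_range`), lies in the
  stratum, is permissible, `H^N` does not increase (InStratum file's `isCanonicalStep_centre_package`), and THE
  INVARIANT PROPAGATES — the identity `part = replayed subscheme` by the label calculus
  `next_part_eq_strictTransformSet` (StrictTransformParts file) with `not_subset_image_support_of_isPermissible`.
* `cycleInvariant_runs` — along every canonical run from such a state: all centres regular, permissible, in the strata.
* `canonicalCentres_isolated` — AT AN ISOLATED ORIGIN of characteristic `p` with `ν ≠ Φ^{(N)}`, for every admissible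
  oracle: every canonical run has `AllRegular ∧ AllPermissible ∧ CentresInStratum N ν`. Hence `StateGood` at the
  origin (`stateGood_init`), and the hypotheses `hperm` / `hcent` / `hreg` of the Compactness, Elimination, Liveness
  and InStratum files are ALL DISCHARGED.
* HEADLINES: `nuMod_isolated_of_tertiaryTermination` — `TertiaryTermination p`, a functional admissible oracle that
  ANSWERS on the reduced closed non-empty subsets of the `ν`-strata met (induction on dimension), `ν ≠ Φ^{(N)}` maximal,
  `X(ν) = {x}` closed, `X` reduced of finite type over a field of characteristic `p`, `dim X ≤ d`, `≤ N`
  ⟹ `TameWild.NuMod X N d ν`; `nuMod_isolated_of_noNearChain` (ONE such oracle without infinite near chain suffices);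
  `noNearChain_iff_terminates_isolated` (O2 at `(X, x)` ⟺ `S(X, ν)` terminates ⟺ not infinite);
  `not_canonicalSequenceInfinite_isolated_of_tertiaryTermination` (the Compactness file's theorem, now hypothesis-free).

What remains as input to the `ν`-modification of an isolated maximal stratum: O2 (`TertiaryTermination p`, OPEN) and
the oracle's answers on the lower-dimensional strata (induction on dimension). Nothing else.

## References

* V. Cossart, U. Jannsen, S. Saito, LNM 2270 (2020), Rem. 6.29 (1) pp. 91–92, p. 92, Lemma 5.34 (3), Thm. 3.3,
  Def. 6.14, p. 107. [CossartJannsenSaito2020]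
* U. Görtz, T. Wedhorn, *Algebraic Geometry I* (2nd ed. 2020), Prop. 13.91, Prop. 13.96 (2). [GortzWedhorn2020]
-/

noncomputable section

set_option linter.dupNamespace false -- mandated namespace of this single-conjunct summit

open CategoryTheory AlgebraicGeometry TopologicalSpace Topology IsLocalRing

namespace Summit.ResolutionOfSingularities.ResolutionOfSingularities.Theorems

namespace CampaignW42

open Literature.AlgebraicGeometry.Resolution Literature.RingTheory.HilbertSamuel
open Summit.ResolutionOfSingularities.ResolutionOfSingularities.Theorems.SigmaMaxModificationsCorridor3

universe u

variable {p : ℕ} {R : ∀ S : Scheme.{u}, CentreSeq S → Prop} {N : ℕ} {ν : ℕ → ℕ}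
variable {k : Type u} [Field k]

/-! ## Replayed centres are regular -/

/-- **A closed immersion transports regular closed subschemes**: for a closed immersion `φ : S → W` and an ideal sheaf
`D` on `S` with `V(D)` regular, the push-forward `φ_* D` (tree/Mathlib `IdealSheafData.map` = kernel of
`V(D) ↪ S → W`) cuts out a regular closed subscheme of `W` — it is the reduced closed subscheme on the image, which a
closed immersion from a regular scheme identifies with its source (`isRegular_subscheme_vanishingIdeal_range`).
[folklore] -/
theorem isRegular_subscheme_map_of_isClosedImmersion {S W : Scheme.{u}} (φ : S ⟶ W) [IsClosedImmersion φ]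
    (D : S.IdealSheafData) (hD : Scheme.IsRegular D.subscheme) : Scheme.IsRegular (D.map φ).subscheme := by
  haveI := hD.isReduced
  have hcl : IsClosed (Set.range (D.subschemeι ≫ φ).base) := (D.subschemeι ≫ φ).isClosedEmbedding.isClosed_range
  have hker : D.map φ = Scheme.IdealSheafData.vanishingIdeal ⟨Set.range (D.subschemeι ≫ φ).base, hcl⟩ :=
    ker_eq_vanishingIdeal_range (D.subschemeι ≫ φ) hcl
  rw [hker]
  exact isRegular_subscheme_vanishingIdeal_range (D.subschemeι ≫ φ) hD

/-- **A permissible centre is a regular closed subscheme** (CJS Def. 3.1 (2), on a locally Noetherian scheme: the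
quotient stalks `𝒪_{S,x}/D_x` are regular, `Scheme.isRegular_subscheme_iff`). [cite: CossartJannsenSaito2020, Def. 3.1 (2)] -/
theorem isRegular_subscheme_of_isPermissible {S : Scheme.{u}} [IsLocallyNoetherian S] {D : S.IdealSheafData}
    (hD : IdealSheafData.IsPermissible D) : Scheme.IsRegular D.subscheme :=
  (Scheme.isRegular_subscheme_iff D).mpr fun x hx => (hD x hx).isRegularLocalRing

/-! ## One canonical step under the cycle invariant -/

/-- **ONE CANONICAL STEP UNDER THE CYCLE INVARIANT, ADMISSIBLE ORACLE.** State: stage `W` of finite type over `k`,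
reduced, `dim W ≤ N`, `ν ≠ Φ^{(N)}` never exceeded by `H^N`, labels `≤` year, and — if a resolution cycle is in
progress (`P = some Q`) — the replayed subscheme IS the label-`Q.lbl` part of `W(ν)`, `Q.lbl ≤ year`, the remaining
centres are permissible and the replayed last stage is regular. Then the centre of a canonical step is REGULAR, lies in
`W(ν)`, is PERMISSIBLE, `H^N` does not increase along the blow-up, and the next state satisfies the same invariant
(label calculus `next_part_eq_strictTransformSet`). [cite: CossartJannsenSaito2020, Rem. 6.29 (1), p. 92, Lemma 5.34 (3), Thm. 3.3] -/
theorem isCanonicalStep_cycle_package (hRa : OracleAdmissible R) (hν : ν ≠ iterPSum N Phi) {W : Scheme.{u}}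
    {L : Labelling W} {P : Option (Pending W)} (hk : ∃ f : W ⟶ Spec (.of k), LocallyOfFiniteType f ∧ QuasiCompact f)
    (hred : IsReduced W) (hdim : topologicalKrullDim W ≤ (N : WithBot ℕ∞))
    (hsup : ∀ w : W, ν ≤ Scheme.hsFun W N w → Scheme.hsFun W N w = ν) (hlab : ∀ Z, L.label Z ≤ L.year)
    (hpend : ∀ Q, P = some Q → Set.range Q.hom.base = L.part (Scheme.hsStratum W N ν) Q.lbl ∧ Q.lbl ≤ L.year ∧
      Q.rest.AllPermissible ∧ Scheme.IsRegular Q.rest.top)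
    {C : W.IdealSheafData} {P' : Option (Pending (blowup C))} (hst : IsCanonicalStep R N ν L P C P') :
    Scheme.IsRegular C.subscheme ∧ (C.support : Set W) ⊆ Scheme.hsStratum W N ν ∧
      IdealSheafData.IsPermissible C ∧
      (∀ z : ↥(blowup C), Scheme.hsFun (blowup C) N z ≤ Scheme.hsFun W N ((blowup.π C).base z)) ∧
      (∃ f' : blowup C ⟶ Spec (.of k), LocallyOfFiniteType f' ∧ QuasiCompact f') ∧ IsReduced (blowup C) ∧
      topologicalKrullDim (blowup C) ≤ (N : WithBot ℕ∞) ∧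
      (∀ z : ↥(blowup C), ν ≤ Scheme.hsFun (blowup C) N z → Scheme.hsFun (blowup C) N z = ν) ∧
      (∀ Z, (L.next (Scheme.hsStratum W N ν) C).label Z ≤ (L.next (Scheme.hsStratum W N ν) C).year) ∧
      ∀ Q', P' = some Q' →
        Set.range Q'.hom.base =
            (L.next (Scheme.hsStratum W N ν) C).part (Scheme.hsStratum (blowup C) N ν) Q'.lbl ∧
          Q'.lbl ≤ (L.next (Scheme.hsStratum W N ν) C).year ∧ Q'.rest.AllPermissible ∧
          Scheme.IsRegular Q'.rest.top := by
  obtain ⟨f, hft, hqc⟩ := hk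
  haveI := hft
  haveI := hqc
  haveI := hred
  haveI : IsLocallyNoetherian W := LocallyOfFiniteType.isLocallyNoetherian f
  haveI : IsNoetherian W := Scheme.isNoetherian_of_finiteType_over_field f
  have hYcl : IsClosed (Scheme.hsStratum W N ν) := by
    rw [hsStratum_eq_hsStratumGE_of_supMax hsup]
    exact isClosed_hsStratumGE_over_field f hdim ν
  have hinv : ∀ Q, P = some Q → Set.range Q.hom.base ⊆ Scheme.hsStratum W N ν :=
    fun Q hQ => ((hpend Q hQ).1).le.trans (L.part_subset _ _)
  -- a label carried by a component is not newer than the year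
  have hlabel_le : ∀ j, (L.part (Scheme.hsStratum W N ν) j).Nonempty → j ≤ L.year := by
    rintro j ⟨y, hy⟩
    obtain ⟨Z, -, hl, -⟩ := (L.mem_part_iff _ j y).mp hy
    exact hl ▸ hlab Z
  -- (0) the centre is regular
  have hCreg : Scheme.IsRegular C.subscheme := by
    cases P with
    | none =>
      obtain ⟨j, hj, hcl, t, hRt, hs⟩ := hst
      cases t with
      | nil _ =>
        obtain ⟨⟨h', rfl⟩, -⟩ := hs
        exact (hRa _ _ hRt).2.2
      | cons D t' =>
        obtain ⟨rfl, -⟩ := hs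
        haveI : IsLocallyNoetherian (Scheme.IdealSheafData.vanishingIdeal
            ⟨L.part (Scheme.hsStratum W N ν) j, hcl⟩).subscheme :=
          LocallyOfFiniteType.isLocallyNoetherian (Scheme.IdealSheafData.vanishingIdeal
            ⟨L.part (Scheme.hsStratum W N ν) j, hcl⟩).subschemeι
        exact isRegular_subscheme_map_of_isClosedImmersion _ D
          (isRegular_subscheme_of_isPermissible ((CentreSeq.allPermissible_cons D t').mp (hRa _ _ hRt).1).1)
    | some Q =>
      haveI := Q.isClosedImmersion
      obtain ⟨hrange, -, hrestperm, hresttop⟩ := hpend Q rfl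
      obtain ⟨-, hs⟩ := hst
      revert hs hrestperm hresttop
      cases Q.rest with
      | nil _ =>
        intro hrestperm hresttop hs
        obtain ⟨⟨h', rfl⟩, -⟩ := hs
        have hC : (⟨L.part (Scheme.hsStratum W N ν) Q.lbl, h'⟩ : Closeds W) =
            ⟨Set.range Q.hom.base, Q.hom.isClosedEmbedding.isClosed_range⟩ := Closeds.ext hrange.symm
        rw [hC]
        exact isRegular_subscheme_vanishingIdeal_range Q.hom hresttop
      | cons D t' =>
        intro hrestperm hresttop hs
        obtain ⟨rfl, -⟩ := hs
        haveI : IsLocallyNoetherian Q.src := LocallyOfFiniteType.isLocallyNoetherian Q.hom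
        exact isRegular_subscheme_map_of_isClosedImmersion _ D
          (isRegular_subscheme_of_isPermissible ((CentreSeq.allPermissible_cons D t').mp hrestperm).1)
  -- (1)–(3) centre in the stratum, permissible, `H^N` monotone, next state over `k`
  obtain ⟨hCsub, hperm, hmono, hk', hred', hdim', hsup', -⟩ :=
    isCanonicalStep_centre_package (k := k) hν ⟨f, hft, hqc⟩ hred hdim hsup hinv hst hCreg
  haveI : IsProper (blowup.π C) := (blowup.isBlowup C).isProper
  haveI : IsLocallyNoetherian (blowup C) := LocallyOfFiniteType.isLocallyNoetherian (blowup.π C ≫ f)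
  haveI : IsNoetherian (blowup C) := Scheme.isNoetherian_of_finiteType_over_field (blowup.π C ≫ f)
  have hYcl' : IsClosed (Scheme.hsStratum (blowup C) N ν) := by
    rw [hsStratum_eq_hsStratumGE_of_supMax hsup']
    exact isClosed_hsStratumGE_over_field (blowup.π C ≫ f) hdim' ν
  have hπY' : (blowup.π C).base '' Scheme.hsStratum (blowup C) N ν ⊆ Scheme.hsStratum W N ν := by
    rintro _ ⟨z, hz, rfl⟩
    exact hsup _ ((Scheme.mem_hsStratum_iff.mp hz).symm.le.trans (hmono z))
  have hST : ∀ T, T ⊆ Scheme.hsStratum W N ν →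
      strictTransformSet (blowup.π C) (C.support : Set W) T ⊆ Scheme.hsStratum (blowup C) N ν :=
    fun T hT => strictTransformSet_subset_hsStratum C hT hYcl'
  -- (4) labels stay `≤` year
  have hlab' : ∀ Z, (L.next (Scheme.hsStratum W N ν) C).label Z ≤ (L.next (Scheme.hsStratum W N ν) C).year := by
    intro Z
    rw [Labelling.next_year]
    by_cases h : closure (blowup.π C '' Z) ∈ componentsIn (Scheme.hsStratum W N ν)
    · rw [L.next_label_of_mem C h]
      exact (hlab _).trans (Nat.le_succ _)
    · rw [L.next_label_of_not_mem C h]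
  refine ⟨hCreg, hCsub, hperm, hmono, hk', hred', hdim', hsup', hlab', ?_⟩
  -- (5) the pending invariant at the next state
  -- the replay lemma: from a replayed subscheme equal to the label-`j` part, a cons-replay step yields the invariant
  have replay : ∀ (j : ℕ) {S : Scheme.{u}} (φ : S ⟶ W) [IsClosedImmersion φ] (D : S.IdealSheafData)
      (t' : CentreSeq (blowup D)), IdealSheafData.IsPermissible D → t'.AllPermissible → Scheme.IsRegular t'.top →
      Set.range φ.base = L.part (Scheme.hsStratum W N ν) j → j ≤ L.year →
      IsReplayStep L (Scheme.hsStratum W N ν) j φ (CentreSeq.cons D t') C P' →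
      ∀ Q', P' = some Q' →
        Set.range Q'.hom.base =
            (L.next (Scheme.hsStratum W N ν) C).part (Scheme.hsStratum (blowup C) N ν) Q'.lbl ∧
          Q'.lbl ≤ (L.next (Scheme.hsStratum W N ν) C).year ∧ Q'.rest.AllPermissible ∧
          Scheme.IsRegular Q'.rest.top := by
    intro j S φ _ D t' hD ht' htop hrange hj hs Q' hQ'
    have hCsupp : (C.support : Set W) = φ.base '' (D.support : Set S) := by
      rw [hs.support_eq_closure]
      exact (φ.isClosedEmbedding.isClosedMap _ D.support.isClosed).closure_eq
    obtain ⟨P'', hP'', hrange''⟩ := hs.range_hom_eq_strictTransformSet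
    obtain ⟨-, φ', hφ', -, hP'⟩ := hs
    obtain rfl : P'' = Q' := Option.some_injective _ (hP''.symm.trans hQ')
    have hQ₀ : P'' = ⟨j, blowup D, φ', hφ', t'⟩ := Option.some_injective _ (hQ'.symm.trans hP')
    have hjC : ∀ Z' ∈ componentsIn (Scheme.hsStratum W N ν), L.label Z' = j → ¬ Z' ⊆ (C.support : Set W) := by
      intro Z' hZ' _
      rw [hCsupp]
      refine not_subset_image_support_of_isPermissible φ hD hYcl ?_ hZ'
      rw [hrange]
      exact L.part_subset _ _
    have hpart := next_part_eq_strictTransformSet C L hYcl hYcl' (componentsIn.finite _) hπY' hST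
      (show j ≠ L.year + 1 by omega) hjC
    subst hQ₀
    refine ⟨?_, ?_, ht', htop⟩
    · rw [hrange'', hrange]
      exact hpart.symm
    · show j ≤ (L.next (Scheme.hsStratum W N ν) C).year
      rw [Labelling.next_year]
      exact hj.trans (Nat.le_succ _)
  intro Q' hQ'
  cases P with
  | none =>
    obtain ⟨j, hj, hcl, t, hRt, hs⟩ := hst
    cases t with
    | nil _ =>
      obtain ⟨-, rfl⟩ := hs
      exact absurd hQ' (by simp)
    | cons D t' =>
      obtain ⟨hDperm, ht'perm⟩ := (CentreSeq.allPermissible_cons D t').mp (hRa _ _ hRt).1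
      have htop : Scheme.IsRegular t'.top := (hRa _ _ hRt).2.2
      have hrange : Set.range (Scheme.IdealSheafData.vanishingIdeal
          ⟨L.part (Scheme.hsStratum W N ν) j, hcl⟩).subschemeι.base = L.part (Scheme.hsStratum W N ν) j := by
        rw [Scheme.IdealSheafData.range_subschemeι, Scheme.IdealSheafData.coe_support_vanishingIdeal]
        rfl
      exact replay j _ D t' hDperm ht'perm htop hrange (hlabel_le j hj.1) hs Q' hQ'
  | some Q =>
    haveI := Q.isClosedImmersion
    obtain ⟨hrange, hlbl, hrestperm, hresttop⟩ := hpend Q rfl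
    obtain ⟨-, hs⟩ := hst
    revert hs hrestperm hresttop
    cases Q.rest with
    | nil _ =>
      intro hrestperm hresttop hs
      obtain ⟨-, rfl⟩ := hs
      exact absurd hQ' (by simp)
    | cons D t' =>
      intro hrestperm hresttop hs
      obtain ⟨hDperm, ht'perm⟩ := (CentreSeq.allPermissible_cons D t').mp hrestperm
      exact replay Q.lbl Q.hom D t' hDperm ht'perm hresttop hrange hlbl hs Q' hQ'

/-! ## Along canonical runs; at an isolated origin -/

/-- **ALONG EVERY CANONICAL RUN FROM A STATE SATISFYING THE CYCLE INVARIANT (admissible oracle): all centres are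
regular, permissible and in the successive `ν`-strata.** [cite: CossartJannsenSaito2020, Rem. 6.29 (1), p. 92, Lemma 5.34 (3)] -/
theorem cycleInvariant_runs (hRa : OracleAdmissible R) (hν : ν ≠ iterPSum N Phi) :
    ∀ {W : Scheme.{u}} {L : Labelling W} {P : Option (Pending W)},
      (∃ f : W ⟶ Spec (.of k), LocallyOfFiniteType f ∧ QuasiCompact f) → IsReduced W →
      topologicalKrullDim W ≤ (N : WithBot ℕ∞) →
      (∀ w : W, ν ≤ Scheme.hsFun W N w → Scheme.hsFun W N w = ν) → (∀ Z, L.label Z ≤ L.year) →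
      (∀ Q, P = some Q → Set.range Q.hom.base = L.part (Scheme.hsStratum W N ν) Q.lbl ∧ Q.lbl ≤ L.year ∧
        Q.rest.AllPermissible ∧ Scheme.IsRegular Q.rest.top) →
      ∀ (t : CentreSeq W), IsCanonicalRunFrom R N ν L P t →
        t.AllRegular ∧ t.AllPermissible ∧ t.CentresInStratum N ν
  | W, L, P, _, _, _, _, _, _, CentreSeq.nil _, _ => ⟨trivial, trivial, trivial⟩
  | W, L, P, hk, hred, hdim, hsup, hlab, hpend, CentreSeq.cons C rest, ht => by
    obtain ⟨P', hst, hrest⟩ := ht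
    obtain ⟨hCreg, hCsub, hperm, -, hk', hred', hdim', hsup', hlab', hpend'⟩ :=
      isCanonicalStep_cycle_package (k := k) hRa hν hk hred hdim hsup hlab hpend hst
    obtain ⟨h1, h2, h3⟩ := cycleInvariant_runs hRa hν hk' hred' hdim' hsup' hlab' hpend' rest hrest
    exact ⟨(CentreSeq.allRegular_cons C rest).mpr ⟨hCreg, h1⟩, (CentreSeq.allPermissible_cons C rest).mpr ⟨hperm, h2⟩,
      (CentreSeq.centresInStratum_cons C rest).mpr ⟨hCsub, h3⟩⟩

/-- **THE CANONICAL CENTRES AT AN ISOLATED ORIGIN ARE REGULAR, PERMISSIBLE AND IN THE STRATA — for EVERY admissible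
oracle** (`ν ≠ Φ^{(N)}`): the hypotheses `hperm` (Compactness/Elimination/Liveness files), `hcent` and `hreg` (InStratum
file) are discharged. CJS Rem. 6.29 (1) with p. 92 «Y_{0,i} = Y_i^{(0)}» and «permissible … by Lemma 5.34 (3)», in the
tree's rendering, every dimension. [cite: CossartJannsenSaito2020, Rem. 6.29 (1), p. 92, Lemma 5.34 (3), Thm. 3.3] -/
theorem canonicalCentres_isolated (hRa : OracleAdmissible R) {X : Scheme.{u}} [IsLocallyNoetherian X] {x : X}
    (hX : IsIsolatedOrigin p N ν X x) (hν : ν ≠ iterPSum N Phi) (t : CentreSeq X) (ht : t.IsCanonicalRun R N ν) :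
    t.AllRegular ∧ t.AllPermissible ∧ t.CentresInStratum N ν := by
  obtain ⟨k, _, _, f, -, hft, hqc⟩ := hX.exists_structure
  exact cycleInvariant_runs (k := k) hRa hν ⟨f, hft, hqc⟩ hX.isReduced hX.dim_le
    (fun w hw => le_antisymm (hX.maximal.2 ⟨w, rfl⟩ hw) hw) (fun _ => le_rfl) (fun Q hQ => absurd hQ (by simp)) t ht

/-- The initial state of an isolated origin is GOOD (`StateGood`, p477843) for every admissible oracle. [folklore] -/
theorem stateGood_init (hRa : OracleAdmissible R) {X : Scheme.{u}} [IsLocallyNoetherian X] {x : X}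
    (hX : IsIsolatedOrigin p N ν X x) (hν : ν ≠ iterPSum N Phi) (f : X ⟶ Spec (.of k)) [LocallyOfFiniteType f]
    [QuasiCompact f] : StateGood k R N ν X (Labelling.init X) none :=
  stateGood_init_of_allRegular hX hν (fun t ht => (canonicalCentres_isolated hRa hX hν t ht).1) f

/-! ## Headlines: O2 + the oracle's answers ⇒ `ν`-modification of an isolated maximal stratum -/

/-- **`TertiaryTermination p` FORBIDS AN INFINITE `S(X, ν)` at every isolated origin** (`ν ≠ Φ^{(N)}`) — the Compactness
file's theorem with its permissibility hypothesis discharged. [cite: CossartJannsenSaito2020, Rem. 6.29 (1), p. 107] -/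
theorem not_canonicalSequenceInfinite_isolated_of_tertiaryTermination (h : TertiaryTermination.{u} p)
    (hRf : OracleFunctional R) (hRa : OracleAdmissible R) {X : Scheme.{u}} [IsLocallyNoetherian X] {x : X}
    (hX : IsIsolatedOrigin p N ν X x) (hν : ν ≠ iterPSum N Phi) : ¬ CanonicalSequenceInfinite R N ν X :=
  not_canonicalSequenceInfinite_of_tertiaryTermination h hRf hRa hX
    fun t ht => (canonicalCentres_isolated hRa hX hν t ht).2.1

/-- **AT AN ISOLATED ORIGIN WHOSE ORACLE ANSWERS ON THE STRATA, THE THREE RENDERINGS OF «THE PROCEDURE ENDS» COINCIDE**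
(functional admissible oracle, `ν ≠ Φ^{(N)}`): no infinite near chain from `(X, x)` ⟺ `S(X, ν)` terminates ⟺ `S(X, ν)`
is not infinite. [cite: CossartJannsenSaito2020, Rem. 6.29 (1), p. 107] -/
theorem noNearChain_iff_terminates_isolated (hRf : OracleFunctional R) (hRa : OracleAdmissible R) {X : Scheme.{u}}
    [IsLocallyNoetherian X] {x : X} (hX : IsIsolatedOrigin p N ν X x) (hν : ν ≠ iterPSum N Phi)
    (htotal : ∀ s : CentreSeq X, s.IsCanonicalRun R N ν → ∀ (Z : Set s.top) (hZ : IsClosed Z),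
      Z ⊆ Scheme.hsStratum s.top N ν → Z.Nonempty →
        ∃ t, R (Scheme.IdealSheafData.vanishingIdeal ⟨Z, hZ⟩).subscheme t) :
    ((NoNearChainFrom R N ν (MarkedStage.init X x) fun _ => True) ↔ CanonicalSequenceTerminates R N ν X) ∧
      (CanonicalSequenceTerminates R N ν X ↔ ¬ CanonicalSequenceInfinite R N ν X) :=
  noNearChain_iff_terminates_iff_not_infinite_of_allRegular hRf hX hν
    (fun t ht => (canonicalCentres_isolated hRa hX hν t ht).1) htotal

/-- **WHAT O2 BUYS, FINAL FORM — `TertiaryTermination p ⇒ ν-MODIFICATION OF EVERY ISOLATED MAXIMAL STRATUM`, every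
dimension.** `X` reduced of finite type over a field of characteristic `p`, `dim X ≤ d`, `dim X ≤ N`,
`ν ≠ Φ^{(N)}` maximal in `Σ_X(N)`, `X(ν) = {x}` with `x` closed (`IsIsolatedOrigin`); `R` ANY functional admissible
oracle which ANSWERS on the reduced closed non-empty subsets of the `ν`-strata met along `S(X, ν)` (the
lower-dimensional canonical resolution sequences — induction on dimension). Then `TameWild.NuMod X N d ν` (CJS Def. 6.14
in modification form, line tame_wild). The canonical centres' regularity, permissibility and position in the strata
(CJS p. 92, Lemma 5.34 (3)), liveness of `S(X, ν)` and GW 13.96 (2) are all PROVED; the inputs are O2 and the answers.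
[cite: CossartJannsenSaito2020, Def. 6.14, Rem. 6.29 (1), p. 92, p. 107, Lemma 5.34 (3), Thm. 3.3] -/
theorem nuMod_isolated_of_tertiaryTermination {p : ℕ} (h : TertiaryTermination.{0} p)
    {R : ∀ S : Scheme.{0}, CentreSeq S → Prop} {N : ℕ} {ν : ℕ → ℕ} (hRf : OracleFunctional R)
    (hRa : OracleAdmissible R) {X : Scheme.{0}} [IsLocallyNoetherian X] {x : X} (hX : IsIsolatedOrigin p N ν X x)
    {d : ℕ} (hdimd : topologicalKrullDim X ≤ (d : WithBot ℕ∞)) (hν : ν ≠ iterPSum N Phi)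
    (htotal : ∀ s : CentreSeq X, s.IsCanonicalRun R N ν → ∀ (Z : Set s.top) (hZ : IsClosed Z),
      Z ⊆ Scheme.hsStratum s.top N ν → Z.Nonempty →
        ∃ t, R (Scheme.IdealSheafData.vanishingIdeal ⟨Z, hZ⟩).subscheme t) :
    TameWild.NuMod X N d ν :=
  nuMod_of_tertiaryTermination_of_allRegular h hRf hRa hX hdimd hν
    (fun t ht => (canonicalCentres_isolated hRa hX hν t ht).1) htotal

/-- **The existential-oracle form, final:** ONE functional admissible oracle answering on the strata WITHOUT an
infinite near chain from `(X, x)` gives `TameWild.NuMod X N d ν` (`ν ≠ Φ^{(N)}`). An adversarial-oracle refutation of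
the universally quantified `TertiaryTermination p` (lane-B note (b) on desk #39) would not touch this use.
[cite: CossartJannsenSaito2020, Def. 6.14, Rem. 6.29 (1)] -/
theorem nuMod_isolated_of_noNearChain {p : ℕ} {R : ∀ S : Scheme.{0}, CentreSeq S → Prop} {N : ℕ} {ν : ℕ → ℕ}
    (hRf : OracleFunctional R) (hRa : OracleAdmissible R) {X : Scheme.{0}} [IsLocallyNoetherian X] {x : X}
    (hX : IsIsolatedOrigin p N ν X x) {d : ℕ} (hdimd : topologicalKrullDim X ≤ (d : WithBot ℕ∞))
    (hν : ν ≠ iterPSum N Phi)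
    (htotal : ∀ s : CentreSeq X, s.IsCanonicalRun R N ν → ∀ (Z : Set s.top) (hZ : IsClosed Z),
      Z ⊆ Scheme.hsStratum s.top N ν → Z.Nonempty →
        ∃ t, R (Scheme.IdealSheafData.vanishingIdeal ⟨Z, hZ⟩).subscheme t)
    (hno : NoNearChainFrom R N ν (MarkedStage.init X x) fun _ => True) : TameWild.NuMod X N d ν :=
  nuMod_of_noNearChain_of_allRegular hRf hX hdimd hν (fun t ht => (canonicalCentres_isolated hRa hX hν t ht).1)
    htotal hno

end CampaignW42

end Summit.ResolutionOfSingularities.ResolutionOfSingularities.Theorems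

end
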